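import Literature.AlgebraicGeometry.Motives.HodgeStructureCentralizerFiniteDirectSumPoints
import Literature.AlgebraicGeometry.Motives.HodgeStructureCentralizerTransportPoints
import HarnessLib

/-!
# Milne 1999 §3 p. 653: "the `k`-algebra `C(A)` is generated by the `γ ∈ S(A)(k)`" along the isogeny decomposition
# `A₁^{r₁} × ⋯ × A_s^{r_s} → A` of Proposition 1.1 — on `K`-points, for every polarized Hodge structure ISOMORPHIC to a finite
# direct sum of powers of pairwise `Hom`-orthogonal summands each satisfying the sentence

[topic AlgebraicGeometry/Motives]

Layer `Literature/AlgebraicGeometry/Motives`, lane `lit-hodgefound` (Track 2 foundations library; seat `lit-hodgefound-p34`,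
generation 24, self-proposed row g24-#4), namespace `Literature.AlgebraicGeometry.Motives.HodgeStructure`. The ASSEMBLY of the
seat's gen-23/24 programme on Milne's sentence (§3 p. 653 L42–L43) on `K`-points: g23-#5 `…EndAlgCentralizerUnitaryGeneration`
(type IV, pairs case) and g24-#1 `…EndAlgCentralizerTwistedBlocks` (types I/II/III) prove `K[S(H)(K)] = C(H)(K)` for the simple
summands; g24-#2 `…CentralizerFiniteDirectSumPoints` passes it to powers (`…_pi_const_eq_centralizer`) and to `Hom`-orthogonal finite
direct sums (`…_pi_eq_centralizer`) on the `pi`-carrier; g24-#3 `…CentralizerTransportPoints` transports it along an isomorphism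
`e : e^* H ⥲ H` (`…_iff_comapEquiv`). Here the three are chained, after the one missing lemma: powers of pairwise `Hom`-orthogonal
Hodge structures are pairwise `Hom`-orthogonal; and the polarization is then discarded (the tree's
`Polarization.lefschetzGroupBaseChange_eq_of_polarization`: `S(H)(K)` does not depend on it — Milne p. 643 L1–L2), so that the
final statements quantify over EVERY polarization of a Hodge structure isomorphic, as a Hodge structure, to such a sum.
THEOREMS ONLY; no definition, no named fact, no `sorry` (D-0026, net debt `0`).

UPDATE (row g24-#5, `Motives/HodgeStructureCentralizerGeneratedByLefschetzGroup`, which does not import this file): the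
hypotheses `hS i` below — and the conclusions of this file, of g23-#5, g24-#1 and g24-#2 — hold for EVERY polarized `ℚ`-Hodge
structure and EVERY field `K ⊇ ℚ`, with no algebraic closure and no hypothesis on the Albert type: `K[S(H)(K)] = C(H)(K)` is
`Polarization.adjoin_coe_lefschetzGroupBaseChange_eq_centralizer_endAlg_baseChange` there (`Hg(H) ≤ S(H)`, Jacobson density —
the seat's g18-#7 `Motives/HodgeStructureLefschetzGroupEnvelopingAlgebra` — and Remark 1.6 "`C′(A) ≅ C(A) ⊗_k k′`"). The
assembly below along Milne's own road (Lemma 3.5, types I–IV, Prop. 1.1) is kept as the formalization of that road, which is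
the one available for a Weil cohomology without `ℚ`-structure; for Hodge structures its hypotheses are always satisfied
(`hS i := (Q i).adjoin_coe_lefschetzGroupBaseChange_eq_centralizer_endAlg_baseChange K`).

## The source, verbatim

J. S. Milne, *Lefschetz classes on abelian varieties*, Duke Math. J. **96** (1999) 639–675 [Milne1999LefschetzClasses] (held
text `paper:doi-10-1215-s0012-7094-99-09620-5`; p0005 = p. 643, p0015 = p. 653):
* (§1 p. 643 L27–L31) "**Proposition 1.1.** Let `A₁, …, A_s` be a set of representatives for the simple isogeny factors of `A`, so
  that there exists an isogeny `A₁^{r₁} × ⋯ × A_s^{r_s} → A` for some `rᵢ > 0`. Any such isogeny induces an isomorphism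
  `C(A₁) × ⋯ × C(A_s) → C(A)` of `k`-algebras with involution, which is independent of the choice of the isogeny."
* (§3 p. 653 L42–L46) "The next lemma shows that the `k`-algebra `C(A)` is generated by the `γ ∈ S(A)(k)`, and so Proposition 3.3
  follows from Proposition 1.3. **Lemma 3.5.** Any semisimple algebra with involution `(R, †)` of finite dimension over an
  algebraically closed field `k` is generated (as a `k`-algebra) by the subset `U` of elements `u` satisfying `u†u = 1`."

## What is PROVED

For a finite family `H i : HodgeStructure (W i) n` (`i : ι`) with polarizations `Q i`, finite non-empty index types `κ i`, the sum
of powers `⊕_i H_i^{κ_i} = HodgeStructure.pi fun i ↦ HodgeStructure.pi fun _ : κ i ↦ H i` polarized by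
`Polarization.pi fun i ↦ Polarization.pi fun _ ↦ Q i`, and a field `K ⊇ ℚ`:
* §1 `Hom.toLinearMap_eq_sum_blocks` (a morphism between powers is the sum of its blocks),
  **`Hom.toLinearMap_pi_const_eq_zero_of_hom_eq_zero`** (`Hom(H_j, H_i) = 0` for `i ≠ j` ⟹ `Hom(H_j^{κ_j}, H_i^{κ_i}) = 0`).
* §2 **`Polarization.adjoin_coe_lefschetzGroupBaseChange_pi_pi_const_eq_centralizer`**: `K[S(H_i)(K)] = C(H_i)(K)` for all `i` and
  pairwise `Hom`-orthogonality ⟹ `K[S(⊕_i H_i^{κ_i})(K)] = C(⊕_i H_i^{κ_i})(K)`;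
  **`Polarization.adjoin_coe_lefschetzGroupBaseChange_eq_centralizer_of_comapEquiv_pi_pi_const`**: the same for
  `(e^* ⊕_i H_i^{κ_i}, e^* ⊕ Q)` along any `ℚ`-linear isomorphism `e : V ⥲ Π_i (κ_i → W_i)`.
* §3 `Polarization.adjoin_coe_lefschetzGroupBaseChange_eq_centralizer_of_polarization_pi_pi_const` (ANY polarization `Q'` of
  `⊕_i H_i^{κ_i}`), **`Polarization.adjoin_coe_lefschetzGroupBaseChange_eq_centralizer_of_eq_comapEquiv_pi_pi_const`**
  (`H' = e^* ⊕_i H_i^{κ_i}` ⟹ `K[S(H', Q')(K)] = C(H')(K)` for EVERY polarization `Q'` of `H'`) and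
  **`Polarization.adjoin_coe_lefschetzGroupBaseChange_eq_centralizer_of_pi_pi_const_eq_comapEquiv`** (the isomorphism written
  `⊕_i H_i^{κ_i} = e^* H'`, the shape of the tree's `AbelianVariety.pi_hodge_one_eq_comapEquiv_biproduct`) — i.e. Milne's
  sentence for every polarized Hodge structure whose Hodge structure is ISOMORPHIC to such a sum.

NOT here (honest scope): that a given polarizable `H` (e.g. `H¹` of an abelian variety) IS isomorphic, as a Hodge structure, to
such a sum `⊕_i H_i^{κ_i}` with summands of Milne's four types (complete reducibility of polarizable Hodge structures — the
tree's `SubHodgeStructure.exists_isCompl`, Voisin I Lemma 7.26 — gives a decomposition into irreducibles; grouping isomorphic ones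
into powers and the Albert typing of `End⁰(H_i)` in the `E_φ`-module language of g23-#5 / g24-#1 are the remaining inputs); the
summand hypotheses themselves (g23-#5, g24-#1). HC is NOT proved; nothing here claims a case of the Hodge conjecture.

## References

* [Milne1999LefschetzClasses] J. S. Milne, *Lefschetz classes on abelian varieties*, Duke Math. J. 96 (1999) 639–675 — §1
  Proposition 1.1 (p. 643 L27–L31), p. 643 L1–L2 and L7–L24; §3 p. 653 L42–L46.
* [DeligneHodgeII1971] P. Deligne, *Théorie de Hodge II*, Publ. Math. IHÉS 40 (1971) — 2.1 (morphisms of direct sums of Hodge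
  structures, blocks).
-/

noncomputable section

open TensorProduct

namespace Literature.AlgebraicGeometry.Motives

namespace HodgeStructure

universe u uK

variable (K : Type uK) [Field K] [Algebra ℚ K] {ι : Type} [Fintype ι] [DecidableEq ι]
  {W : ι → Type u} [∀ i, AddCommGroup (W i)] [∀ i, Module ℚ (W i)] {n : ℤ}
  (H : ∀ i, HodgeStructure (W i) n) (Q : ∀ i, Polarization (H i))
  (κ : ι → Type) [∀ i, Fintype (κ i)] [∀ i, DecidableEq (κ i)]

/-! ## §1 Powers of pairwise `Hom`-orthogonal Hodge structures are pairwise `Hom`-orthogonal -/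

omit [Fintype ι] [DecidableEq ι] in
/-- **A morphism between finite direct sums is the sum of its blocks**: `φ = Σ_{a,b} in_a (pr_a φ in_b) pr_b` on underlying
linear maps. [cite: DeligneHodgeII1971, 2.1] -/
theorem Hom.toLinearMap_eq_sum_blocks {i j : ι} (φ : Hom (HodgeStructure.pi fun _ : κ j ↦ H j) (HodgeStructure.pi fun _ : κ i ↦ H i)) :
    φ.toLinearMap = ∑ a, ∑ b, LinearMap.single ℚ (fun _ : κ i ↦ W i) a ∘ₗ
      ((LinearMap.proj a : (κ i → W i) →ₗ[ℚ] W i) ∘ₗ φ.toLinearMap ∘ₗ LinearMap.single ℚ (fun _ : κ j ↦ W j) b) ∘ₗ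
        (LinearMap.proj b : (κ j → W j) →ₗ[ℚ] W j) := by
  refine LinearMap.ext fun x ↦ funext fun k ↦ ?_
  simp only [LinearMap.coe_sum, Finset.sum_apply, LinearMap.coe_comp, Function.comp_apply, LinearMap.coe_proj,
    Function.eval, LinearMap.coe_single]
  rw [Finset.sum_eq_single k]
  · simp only [Pi.single_eq_same]
    conv_lhs => rw [← Finset.univ_sum_single x, map_sum, Finset.sum_apply]
  · intro a _ hak
    simp [Pi.single_eq_of_ne (Ne.symm hak)]
  · exact fun h ↦ (h (Finset.mem_univ k)).elim

omit [Fintype ι] [DecidableEq ι] in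
/-- **`Hom(H_j, H_i) = 0` ⟹ `Hom(H_j^{κ_j}, H_i^{κ_i}) = 0`**: every block of a morphism between the powers is a morphism
`H_j → H_i` ("`A₁, …, A_s` pairwise nonisogenous ⟹ `Hom(A_i^{r_i}, A_j^{r_j}) = 0`", the hypothesis of Prop. 1.1 for the powers).
[cite: Milne1999LefschetzClasses, §1 Proposition 1.1 (p. 643 L27–L31)] [cite: DeligneHodgeII1971, 2.1] -/
theorem Hom.toLinearMap_pi_const_eq_zero_of_hom_eq_zero (h0 : ∀ i j, i ≠ j → ∀ φ : Hom (H j) (H i), φ.toLinearMap = 0)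
    {i j : ι} (hij : i ≠ j) (φ : Hom (HodgeStructure.pi fun _ : κ j ↦ H j) (HodgeStructure.pi fun _ : κ i ↦ H i)) :
    φ.toLinearMap = 0 := by
  rw [Hom.toLinearMap_eq_sum_blocks H κ φ]
  refine Finset.sum_eq_zero fun a _ ↦ Finset.sum_eq_zero fun b _ ↦ ?_
  have hblock : (LinearMap.proj a : (κ i → W i) →ₗ[ℚ] W i) ∘ₗ φ.toLinearMap ∘ₗ LinearMap.single ℚ (fun _ : κ j ↦ W j) b = 0 :=
    h0 i j hij ((Hom.piProj (fun _ : κ i ↦ H i) a).comp (φ.comp (Hom.piSingle (fun _ : κ j ↦ H j) b)))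
  rw [hblock, LinearMap.zero_comp, LinearMap.comp_zero]

/-! ## §2 "The `k`-algebra `C(A)` is generated by the `γ ∈ S(A)(k)`" for `A ~ A₁^{r₁} × ⋯ × A_s^{r_s}` -/

variable [∀ i, Module.Finite ℚ (W i)] [∀ i, Nonempty (κ i)]

/-- **Milne's sentence for a sum of powers**: if `K[S(H_i)(K)] = C(H_i)(K)` for every `i` and the `H_i` are pairwise
`Hom`-orthogonal, then `K[S(⊕_i H_i^{κ_i})(K)] = C(⊕_i H_i^{κ_i})(K)` for the direct-sum polarization — the reduction of the
proof of Proposition 3.3 / Lemma 3.5 along Proposition 1.1 ("there exists an isogeny `A₁^{r₁} × ⋯ × A_s^{r_s} → A`"), assembled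
from the seat's `…_pi_const_eq_centralizer` (powers) and `…_pi_eq_centralizer` (`Hom`-orthogonal sums).
[cite: Milne1999LefschetzClasses, §3 p. 653 L42–L46 with §1 Proposition 1.1 (p. 643 L27–L31)] -/
theorem Polarization.adjoin_coe_lefschetzGroupBaseChange_pi_pi_const_eq_centralizer
    (h0 : ∀ i j, i ≠ j → ∀ φ : Hom (H j) (H i), φ.toLinearMap = 0)
    (hS : ∀ i, Algebra.adjoin K ((fun γ : (K ⊗[ℚ] W i) ≃ₗ[K] (K ⊗[ℚ] W i) ↦ (γ : Module.End K (K ⊗[ℚ] W i))) ''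
        ((Q i).lefschetzGroupBaseChange K : Set _)) =
      Subalgebra.centralizer K ((fun a : Module.End ℚ (W i) ↦ a.baseChange K) '' ((H i).endAlg : Set (Module.End ℚ (W i))))) :
    Algebra.adjoin K ((fun γ : (K ⊗[ℚ] (∀ i, κ i → W i)) ≃ₗ[K] (K ⊗[ℚ] (∀ i, κ i → W i)) ↦
        (γ : Module.End K (K ⊗[ℚ] (∀ i, κ i → W i)))) ''
          ((Polarization.pi fun i ↦ Polarization.pi fun _ : κ i ↦ Q i).lefschetzGroupBaseChange K : Set _)) =
      Subalgebra.centralizer K ((fun a : Module.End ℚ (∀ i, κ i → W i) ↦ a.baseChange K) ''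
        ((HodgeStructure.pi fun i ↦ HodgeStructure.pi fun _ : κ i ↦ H i).endAlg : Set (Module.End ℚ (∀ i, κ i → W i)))) :=
  Polarization.adjoin_coe_lefschetzGroupBaseChange_pi_eq_centralizer K
    (H := fun i ↦ HodgeStructure.pi fun _ : κ i ↦ H i) (Q := fun i ↦ Polarization.pi fun _ : κ i ↦ Q i)
    (fun _ _ hij φ ↦ Hom.toLinearMap_pi_const_eq_zero_of_hom_eq_zero H κ h0 hij φ)
    fun i ↦ Polarization.adjoin_coe_lefschetzGroupBaseChange_pi_const_eq_centralizer K (Q i) (hS i)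

/-- **Milne's sentence for every polarized Hodge structure ISOMORPHIC to a sum of powers of pairwise `Hom`-orthogonal summands
each satisfying it** ("Let `A₁, …, A_s` be a set of representatives for the simple isogeny factors of `A`, so that there exists
an isogeny `A₁^{r₁} × ⋯ × A_s^{r_s} → A`" — on the rational Hodge structure an isomorphism `e`; the summand statements are the
seat's g23-#5 (type IV, pairs case) and g24-#1 (types I/II/III)): for `(H, Q) = e^* (⊕_i H_i^{κ_i}, ⊕_i ⊕ Q_i)`,
`K[S(H)(K)] = C(H)(K)`. [cite: Milne1999LefschetzClasses, §3 p. 653 L42–L46 with §1 Proposition 1.1 (p. 643 L27–L31) and p. 643 L7–L11] -/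
theorem Polarization.adjoin_coe_lefschetzGroupBaseChange_eq_centralizer_of_comapEquiv_pi_pi_const
    {V : Type u} [AddCommGroup V] [Module ℚ V] [Module.Finite ℚ V] (e : V ≃ₗ[ℚ] (∀ i, κ i → W i))
    (h0 : ∀ i j, i ≠ j → ∀ φ : Hom (H j) (H i), φ.toLinearMap = 0)
    (hS : ∀ i, Algebra.adjoin K ((fun γ : (K ⊗[ℚ] W i) ≃ₗ[K] (K ⊗[ℚ] W i) ↦ (γ : Module.End K (K ⊗[ℚ] W i))) ''
        ((Q i).lefschetzGroupBaseChange K : Set _)) =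
      Subalgebra.centralizer K ((fun a : Module.End ℚ (W i) ↦ a.baseChange K) '' ((H i).endAlg : Set (Module.End ℚ (W i))))) :
    Algebra.adjoin K ((fun γ : (K ⊗[ℚ] V) ≃ₗ[K] (K ⊗[ℚ] V) ↦ (γ : Module.End K (K ⊗[ℚ] V))) ''
        (((Polarization.pi fun i ↦ Polarization.pi fun _ : κ i ↦ Q i).comapEquiv e).lefschetzGroupBaseChange K : Set _)) =
      Subalgebra.centralizer K ((fun a : Module.End ℚ V ↦ a.baseChange K) ''
        (((HodgeStructure.pi fun i ↦ HodgeStructure.pi fun _ : κ i ↦ H i).comapEquiv e).endAlg : Set (Module.End ℚ V))) :=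
  ((Polarization.pi fun i ↦ Polarization.pi fun _ : κ i ↦ Q i).adjoin_coe_lefschetzGroupBaseChange_eq_centralizer_iff_comapEquiv
      K e).2 (Polarization.adjoin_coe_lefschetzGroupBaseChange_pi_pi_const_eq_centralizer K H Q κ h0 hS)

/-! ## §3 Independence of the polarization; either direction of the isomorphism -/

/-- **The conclusion does not depend on the polarization** (Milne p. 643 L1–L2: "the restriction of `†` to `C(A)` is
independent of the choice of `D`"; the tree's `Polarization.lefschetzGroupBaseChange_eq_of_polarization`): for EVERY
polarization `Q'` of `⊕_i H_i^{κ_i}`, `K[S(⊕_i H_i^{κ_i}, Q')(K)] = C(⊕_i H_i^{κ_i})(K)`.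
[cite: Milne1999LefschetzClasses, §3 p. 653 L42–L46 with §1 Proposition 1.1 (p. 643 L27–L31) and p. 643 L1–L2] -/
theorem Polarization.adjoin_coe_lefschetzGroupBaseChange_eq_centralizer_of_polarization_pi_pi_const
    (Q' : Polarization (HodgeStructure.pi fun i ↦ HodgeStructure.pi fun _ : κ i ↦ H i))
    (h0 : ∀ i j, i ≠ j → ∀ φ : Hom (H j) (H i), φ.toLinearMap = 0)
    (hS : ∀ i, Algebra.adjoin K ((fun γ : (K ⊗[ℚ] W i) ≃ₗ[K] (K ⊗[ℚ] W i) ↦ (γ : Module.End K (K ⊗[ℚ] W i))) ''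
        ((Q i).lefschetzGroupBaseChange K : Set _)) =
      Subalgebra.centralizer K ((fun a : Module.End ℚ (W i) ↦ a.baseChange K) '' ((H i).endAlg : Set (Module.End ℚ (W i))))) :
    Algebra.adjoin K ((fun γ : (K ⊗[ℚ] (∀ i, κ i → W i)) ≃ₗ[K] (K ⊗[ℚ] (∀ i, κ i → W i)) ↦
        (γ : Module.End K (K ⊗[ℚ] (∀ i, κ i → W i)))) '' (Q'.lefschetzGroupBaseChange K : Set _)) =
      Subalgebra.centralizer K ((fun a : Module.End ℚ (∀ i, κ i → W i) ↦ a.baseChange K) ''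
        ((HodgeStructure.pi fun i ↦ HodgeStructure.pi fun _ : κ i ↦ H i).endAlg : Set (Module.End ℚ (∀ i, κ i → W i)))) := by
  haveI : HodgeTensorFacts.{u, u} := hodgeTensorFacts_holds
  rw [Q'.lefschetzGroupBaseChange_eq_of_polarization K (Polarization.pi fun i ↦ Polarization.pi fun _ : κ i ↦ Q i)]
  exact Polarization.adjoin_coe_lefschetzGroupBaseChange_pi_pi_const_eq_centralizer K H Q κ h0 hS

/-- **Milne's sentence for every polarized Hodge structure `(H', Q')` whose Hodge structure is ISOMORPHIC to a sum of powers
`⊕_i H_i^{κ_i}` of pairwise `Hom`-orthogonal summands each satisfying it, for EVERY polarization `Q'` of `H'`** — the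
isomorphism in the tree's idiom `H' = e^* (⊕_i H_i^{κ_i})` (`HodgeStructure.comapEquiv`; e.g. the shape of the tree's
`AbelianVariety.pi_hodge_one_eq_comapEquiv_biproduct`, `Pohlmann1968.hodge_one_eq_comapEquiv_of_isIsogeny`): `K[S(H', Q')(K)] = C(H')(K)`.
("there exists an isogeny `A₁^{r₁} × ⋯ × A_s^{r_s} → A` … the `k`-algebra `C(A)` is generated by the `γ ∈ S(A)(k)`"; the
polarization is immaterial by `Polarization.lefschetzGroupBaseChange_eq_of_polarization`.)
[cite: Milne1999LefschetzClasses, §3 p. 653 L42–L46 with §1 Proposition 1.1 (p. 643 L27–L31), p. 643 L1–L2 and L7–L11] -/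
theorem Polarization.adjoin_coe_lefschetzGroupBaseChange_eq_centralizer_of_eq_comapEquiv_pi_pi_const
    {V : Type u} [AddCommGroup V] [Module ℚ V] [Module.Finite ℚ V] {H' : HodgeStructure V n} (Q' : Polarization H')
    (e : V ≃ₗ[ℚ] (∀ i, κ i → W i)) (hH : H' = (HodgeStructure.pi fun i ↦ HodgeStructure.pi fun _ : κ i ↦ H i).comapEquiv e)
    (h0 : ∀ i j, i ≠ j → ∀ φ : Hom (H j) (H i), φ.toLinearMap = 0)
    (hS : ∀ i, Algebra.adjoin K ((fun γ : (K ⊗[ℚ] W i) ≃ₗ[K] (K ⊗[ℚ] W i) ↦ (γ : Module.End K (K ⊗[ℚ] W i))) ''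
        ((Q i).lefschetzGroupBaseChange K : Set _)) =
      Subalgebra.centralizer K ((fun a : Module.End ℚ (W i) ↦ a.baseChange K) '' ((H i).endAlg : Set (Module.End ℚ (W i))))) :
    Algebra.adjoin K ((fun γ : (K ⊗[ℚ] V) ≃ₗ[K] (K ⊗[ℚ] V) ↦ (γ : Module.End K (K ⊗[ℚ] V))) ''
        (Q'.lefschetzGroupBaseChange K : Set _)) =
      Subalgebra.centralizer K ((fun a : Module.End ℚ V ↦ a.baseChange K) '' (H'.endAlg : Set (Module.End ℚ V))) := by
  subst hH
  haveI : HodgeTensorFacts.{u, u} := hodgeTensorFacts_holds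
  rw [Q'.lefschetzGroupBaseChange_eq_of_polarization K
    ((Polarization.pi fun i ↦ Polarization.pi fun _ : κ i ↦ Q i).comapEquiv e)]
  exact Polarization.adjoin_coe_lefschetzGroupBaseChange_eq_centralizer_of_comapEquiv_pi_pi_const K H Q κ e h0 hS

/-- **The same with the isomorphism written in the other direction**, `⊕_i H_i^{κ_i} = e^* H'` (the shape of the tree's
`AbelianVariety.pi_hodge_one_eq_comapEquiv_biproduct : ⊕_j H¹(A_j) = e^* H¹(⨁_j A_j)`): `K[S(H', Q')(K)] = C(H')(K)` for every
polarization `Q'` of `H'`. [cite: Milne1999LefschetzClasses, §3 p. 653 L42–L46 with §1 Proposition 1.1 (p. 643 L27–L31), p. 643 L1–L2 and L7–L11] -/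
theorem Polarization.adjoin_coe_lefschetzGroupBaseChange_eq_centralizer_of_pi_pi_const_eq_comapEquiv
    {V : Type u} [AddCommGroup V] [Module ℚ V] [Module.Finite ℚ V] {H' : HodgeStructure V n} (Q' : Polarization H')
    (e : (∀ i, κ i → W i) ≃ₗ[ℚ] V) (hH : (HodgeStructure.pi fun i ↦ HodgeStructure.pi fun _ : κ i ↦ H i) = H'.comapEquiv e)
    (h0 : ∀ i j, i ≠ j → ∀ φ : Hom (H j) (H i), φ.toLinearMap = 0)
    (hS : ∀ i, Algebra.adjoin K ((fun γ : (K ⊗[ℚ] W i) ≃ₗ[K] (K ⊗[ℚ] W i) ↦ (γ : Module.End K (K ⊗[ℚ] W i))) ''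
        ((Q i).lefschetzGroupBaseChange K : Set _)) =
      Subalgebra.centralizer K ((fun a : Module.End ℚ (W i) ↦ a.baseChange K) '' ((H i).endAlg : Set (Module.End ℚ (W i))))) :
    Algebra.adjoin K ((fun γ : (K ⊗[ℚ] V) ≃ₗ[K] (K ⊗[ℚ] V) ↦ (γ : Module.End K (K ⊗[ℚ] V))) ''
        (Q'.lefschetzGroupBaseChange K : Set _)) =
      Subalgebra.centralizer K ((fun a : Module.End ℚ V ↦ a.baseChange K) '' (H'.endAlg : Set (Module.End ℚ V))) :=
  Polarization.adjoin_coe_lefschetzGroupBaseChange_eq_centralizer_of_eq_comapEquiv_pi_pi_const K H Q κ Q' e.symm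
    (by rw [hH, HodgeStructure.comapEquiv_symm_comapEquiv]) h0 hS

end HodgeStructure

end Literature.AlgebraicGeometry.Motives

end
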